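import Literature.Algebra.Homology.DiscreteRepLayerColimitGroupCohomology
import Mathlib.RepresentationTheory.Homological.GroupCohomology.LowDegree
import HarnessLib

/-!
# `H¹(Γ, ℤ) = 0` for a profinite group, in `Ext` form: `Ext¹_{C_Γ}(ℤ, ℤ) = 0`

Topic `Algebra/Homology`; namespace `Literature.Algebra.Homology.DiscreteRep`.  Theorems only; no
definition, no named fact, no instance, no `sorry`.  Sequel of `DiscreteRepLayerColimitGroupCohomology`
((d) with layers in Mathlib's `groupCohomology`: the vanishing transfer
`ext_eq_zero_of_forall_exists_stepG_eq_zero`).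

Milne (ADT I, Lemma 1.7: `α¹(G, ℤ) : 0 → 0`) and Harari (§16.3) use `H¹(G, ℤ) = Hom_cont(G, ℤ) = 0`
for a profinite `G`.  Here: `Ext¹_{C_Γ}(triv ℤ, triv ℤ) = 0` for `Γ` compact and totally disconnected,
because every layer `H¹(Γ⧸U, ℤ) = Hom(Γ⧸U, ℤ)` (finite group, torsion-free coefficients) vanishes:

* `isTrivial_invariantsQuot_triv`: the layer `(triv V)^U` is a trivial `Γ⧸U`-representation;
* `addMonoidHom_apply_eq_zero_of_finite`: a homomorphism from a finite group to a torsion-free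
  `ℤ`-module is zero; `groupCohomology_one_eq_zero_of_isTrivial`: `H¹(G, A) = 0` for `G` finite and
  `A` trivial torsion-free (Mathlib `H1IsoOfIsTrivial`);
* **`ext_one_triv_int_eq_zero`**: `Ext¹_{C_Γ}(ℤ, ℤ) = 0` — this discharges the hypothesis
  `ext_one_triv_eq_zero` of `DiscreteRepTateDuality.TateDualityHypotheses` (door-c4 g15) at every
  open subgroup.

Written for Route A of the Poitou–Tate programme of crux `stmt-BirchSwinnertonDyer-19295` (cell
`bsd-schneider-ideate`, seat door-c4 gen 15).  HONEST FRAMING: homological algebra only.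

## References
* J. S. Milne, *Arithmetic Duality Theorems* (2nd ed. 2006), I §1, Lemma 1.7 (`α¹(G, ℤ)`). [MilneADT2006]
* J.-P. Serre, *Galois Cohomology*, Springer (1997), I §2.2 Proposition 8 (`H^q(G, A) = lim→ H^q(G/U, A^U)`).
  [SerreGaloisCohomology1997]
-/

noncomputable section

universe u

namespace Literature.Algebra.Homology

namespace DiscreteRep

open CategoryTheory CategoryTheory.Limits CategoryTheory.Abelian Representation

/-! ## §1 Homomorphisms from a finite group to a torsion-free module -/

/-- A group homomorphism from a finite group to a torsion-free `ℤ`-module is zero.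
[cite: MilneADT2006, I Lemma 1.7] -/
theorem addMonoidHom_apply_eq_zero_of_finite {G : Type*} [Group G] [Finite G] {A : Type*}
    [AddCommGroup A] [NoZeroSMulDivisors ℤ A] (f : Additive G →+ A) (g : Additive G) : f g = 0 := by
  have hcard : (Nat.card G : ℤ) ≠ 0 := by exact_mod_cast Nat.card_pos.ne'
  have hg : (Nat.card G : ℤ) • g = 0 := by
    rw [natCast_zsmul, ← ofMul_toMul g, ← ofMul_pow, pow_card_eq_one', ofMul_one]
  have h : (Nat.card G : ℤ) • f g = 0 := by rw [← map_zsmul, hg, map_zero]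
  exact (smul_eq_zero.1 h).resolve_left hcard

/-- **`H¹(G, A) = 0` for `G` finite and `A` a trivial, torsion-free `G`-module** (`H¹ = Hom(G, A)`,
Mathlib `H1IsoOfIsTrivial`). [cite: MilneADT2006, I Lemma 1.7] -/
theorem groupCohomology_one_eq_zero_of_isTrivial {G : Type} [Group G] [Finite G] (A : Rep ℤ G)
    [A.IsTrivial] [NoZeroSMulDivisors ℤ A.V] (c : groupCohomology A 1) : c = 0 := by
  have h1 : (groupCohomology.H1IsoOfIsTrivial A).hom c = 0 :=
    AddMonoidHom.ext fun g => addMonoidHom_apply_eq_zero_of_finite _ g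
  have h2 : (groupCohomology.H1IsoOfIsTrivial A).inv ((groupCohomology.H1IsoOfIsTrivial A).hom c) = c :=
    LinearMap.congr_fun (congrArg ModuleCat.Hom.hom (groupCohomology.H1IsoOfIsTrivial A).hom_inv_id) c
  rw [← h2, h1, map_zero]

/-! ## §2 The layers `(triv V)^U` are trivial, torsion-free -/

variable {k Γ : Type u} [CommRing k] [Group Γ] [TopologicalSpace Γ]

/-- The layer `(triv V)^U`, as a representation of `Γ⧸U`, is trivial. [cite: SerreGaloisCohomology1997, I §2.2 Proposition 8] -/
theorem isTrivial_invariantsQuot_triv (U : Subgroup Γ) [U.Normal] (V : Type u) [AddCommGroup V] [Module k V] :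
    ((invariantsQuotFunctor k U).obj (triv (k := k) (Γ := Γ) V)).IsTrivial :=
  ⟨fun g => QuotientGroup.induction_on g fun _ => LinearMap.ext fun _ => Subtype.ext rfl⟩

/-- The layer `(triv ℤ)^U` is torsion-free (a subgroup of `ℤ`). [cite: MilneADT2006, I Lemma 1.7] -/
theorem noZeroSMulDivisors_invariantsQuot_triv_int {Δ : Type} [Group Δ] [TopologicalSpace Δ]
    (U : Subgroup Δ) [U.Normal] :
    NoZeroSMulDivisors ℤ ((invariantsQuotFunctor ℤ U).obj (triv (k := ℤ) (Γ := Δ) ℤ)).V :=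
  inferInstanceAs (NoZeroSMulDivisors ℤ
    (invariants ((Representation.trivial ℤ Δ ℤ).comp U.subtype) : Submodule ℤ ℤ))

/-! ## §3 `Ext¹_{C_Γ}(ℤ, ℤ) = 0` for `Γ` profinite -/

/-- **`H¹(Γ, ℤ) = 0` for a profinite group, `Ext` form: `Ext¹_{C_Γ}(triv ℤ, triv ℤ) = 0`** (every
layer `H¹(Γ⧸U, ℤ) = Hom(Γ⧸U, ℤ) = 0` and (d)).
[cite: MilneADT2006, I Lemma 1.7][cite: SerreGaloisCohomology1997, I §2.2 Proposition 8] -/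
theorem ext_one_triv_int_eq_zero {Δ : Type} [Group Δ] [TopologicalSpace Δ] [IsTopologicalGroup Δ]
    [CompactSpace Δ] [TotallyDisconnectedSpace Δ]
    (y : Ext (triv (k := ℤ) (Γ := Δ) ℤ) (triv (k := ℤ) (Γ := Δ) ℤ) 1) : y = 0 := by
  refine LayerColimit.ext_eq_zero_of_forall_exists_stepG_eq_zero 1 (triv (k := ℤ) (Γ := Δ) ℤ)
    (fun U c => ⟨U, le_rfl, ?_⟩) y
  haveI := isTrivial_invariantsQuot_triv (k := ℤ) (U : Subgroup Δ) ℤ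
  haveI := noZeroSMulDivisors_invariantsQuot_triv_int (Δ := Δ) (U : Subgroup Δ)
  rw [groupCohomology_one_eq_zero_of_isTrivial _ c, map_zero]

/-- The same over an open subgroup `U` of a profinite group `Γ` (as needed at every layer of a class
formation: the hypothesis `ext_one_triv_eq_zero` of `TateDualityHypotheses`).
[cite: MilneADT2006, I Lemma 1.7] -/
theorem ext_one_triv_int_eq_zero_openSubgroup {Γ : Type} [Group Γ] [TopologicalSpace Γ]
    [IsTopologicalGroup Γ] [CompactSpace Γ] [TotallyDisconnectedSpace Γ] (U : OpenNormalSubgroup Γ)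
    (y : Ext (triv (k := ℤ) (Γ := (U : Subgroup Γ)) ℤ) (triv (k := ℤ) (Γ := (U : Subgroup Γ)) ℤ) 1) :
    y = 0 :=
  haveI : CompactSpace (U : Subgroup Γ) := isCompact_iff_compactSpace.1 U.toOpenSubgroup.isClosed.isCompact
  ext_one_triv_int_eq_zero y

end DiscreteRep

end Literature.Algebra.Homology
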